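import Mathlib
import HarnessLib
import Literature.Probability.LatticeModels.IsingThermodynamics
import Literature.Probability.LatticeModels.ThermodynamicLimit
import Summits.CriticalPhenomena.Ising3DConformalLimit.Theorems.PrecisionLaplacianDirectCorrelationStableTailSlabModeExpDecayCrossAssemblyAux2
import Summits.CriticalPhenomena.Ising3DConformalLimit.Theorems.PrecisionLaplacianDirectCorrelationStableTailSlabModeExpDecayPaleyWienerAux

/-!
# Brick `stub_slabModeExpDecay_auxCrossAssembly` of stub `stub_slabModeExpDecay` (line
# `self-energy-pick-inversion`, crux `PrecisionLaplacian.DirectCorrelationStableTail`,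
# stmt-CriticalPhenomena-4799): THE CROSS ASSEMBLY — line holomorphy in the nine frames + the
# Bernstein–Siciak cross lemma ⇒ the G-side transverse mass gap `HypG`

**Statement** (registered sub-stub `stub_slabModeExpDecay_auxCrossAssembly`, text of the lead's
interface `crossAssembly_SHAPE`).  Let `G = criticalTwoPoint 3` satisfy `H` (symmetric-potential
kernel matrices), `A₀ = lim (M_{Λ_n})⁻¹(0,0)`, `q = 𝟙_{≠0} dcf / A₀` the step law of the walk
dictionary and `g(p) = (1 - ∑ₓ q(x) cos(p·x))⁻¹` the Green symbol function on `ℝ³`.  HYPOTHESES: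
(LH) LINE HOLOMORPHY in the nine frames `u ∈ {eᵢ} ∪ {eᵢ ± eⱼ}` — a universal `c₀ > 0` and for all
margins `d, m > 0` a bound `B(d, m)` such that along every `u`-line `{p + t w_u}` (`w_u = u/|u|²`)
with `dist(p·u, 2πℤ) ≥ d` staying at sup-distance `≥ m` from `(2πℤ)³`, `t ↦ g(p + t w_u)` continues
holomorphically to `|t| < c₀ d` with `‖·‖ ≤ B`; (CROSS) the Bernstein–Siciak cross lemma for the
three-armed cross `X = ⋃ⱼ {t : t_l ∈ [-1,1] (l ≠ j), |t_j| < 2} ⊂ ℂ³` with a radius `ρ`.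
CONCLUSION (`HypG`, hypothesis 2 of `stub_slabModeExpDecay_auxGreenTransfer`): there is `c > 0`
such that for every direction `i`, every good reduced transverse momentum `k` (`|k_j| < π`,
`k ≠ 0`) and every `c' < c`, the sharp-momentum slab transforms
`h_n(k) = ∫_{-π}^{π} cos(nθ) g(ins_i(θ, k)) dθ` are eventually `≤ C e^{-c'‖k‖n}`.

**Proof** (`c = min(c₀,1) min(ρ,1)/4`).  Fix `i`, `k`, `K = ‖k‖_∞`.  For every real `θ` the
function `s ↦ g(ins_i(s, k))` continues holomorphically to the disc `B(θ, cK)`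
(`exists_local_extension`): if `dist(θ, 2πℤ) ≥ K/4` directly by line holomorphy along the axis
line `eᵢ` through `ins_i(θ, k)` (Case A, `exists_local_extension_of_far`); otherwise (Case B,
`exists_local_extension_of_near`, file `…CrossAssemblyAux2`) by ONE application of the cross
lemma to the two families of diagonal lines `eᵢ ± eₐ` (`a` the slot of the largest coordinate of
`k`) through the points of a parallelogram of size `∝ K` around `ins_i(θ, k)` — all admissible with
margins `(K/2, K/4)` — followed by restriction of the polydisc extension to the complex diagonal
`w₊ + w₋ = eᵢ`.  These disc continuations glue (identity theorem) to a holomorphic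
function on the strip `{|Im z| < cK}` with the `2π`-periodic real trace `θ ↦ g(ins_i(θ, k))`
(`exists_differentiableOn_strip_of_balls`, file `…CrossAssemblyAux`), and the landed Paley–Wiener
lemma (`abs_integral_mul_cos_le_of_strip`, `exists_norm_le_of_strip`, file `…PaleyWienerAux`) gives
`|h_n(k)| ≤ 2πM e^{-c'Kn}` for every `c' < c` and all `n`.  The rate is LINEAR in `K` because all
margins are proportional to `K`; the bound `B(K/2, K/4)` only enters the constant.

Pure theorem file, no definitions, no `sorry`.  References: S. N. Bernstein (1912); J. Siciak,
Ann. Polon. Math. 22 (1969); M. Jarnicki, P. Pflug, *Extension of Holomorphic Functions*, Ch. 5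
[JarnickiPflug2011]; Paley–Wiener for Fourier series (Katznelson, I.4).
-/

noncomputable section

namespace Summit.CriticalPhenomena.Ising3DConformalLimit.Cruxes.DirectCorrelationStableTail.SelfEnergyPickInversion

open MeasureTheory Filter Topology Complex Metric Set
open scoped BigOperators Real
open Literature.Probability.LatticeModels

/-! ### Case A: `θ` far from `2πℤ` -/

/-- **Case A.** If `dist(θ, 2πℤ) ≥ K/4` (`K = ‖k‖_∞ > 0`, `|k_j| < π`), line holomorphy along the
axis line `eᵢ` through `ins_i(θ, k)` continues `s ↦ g(ins_i(s, k))` holomorphically to the disc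
`B(θ, c₀K/4)`. [folklore] -/
theorem exists_local_extension_of_far {g : (Fin 3 → ℝ) → ℝ} {c₀ : ℝ}
    (hLH : ∀ (d m : ℝ), 0 < d → 0 < m → ∃ B : ℝ,
      ∀ u : Site 3, ((∃ i : Fin 3, u = Pi.single i 1) ∨
          ∃ i j : Fin 3, i ≠ j ∧ (u = Pi.single i 1 + Pi.single j 1 ∨ u = Pi.single i 1 - Pi.single j 1)) →
      ∀ p : Fin 3 → ℝ, (∀ n : ℤ, d ≤ |(∑ j, p j * (u j : ℝ)) - 2 * Real.pi * n|) →
        (∀ (t : ℝ) (L : Fin 3 → ℤ), m ≤ ‖(fun j => p j + t * ((u j : ℝ) / ∑ l, ((u l : ℝ)) ^ 2)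
          - 2 * Real.pi * (L j : ℝ))‖) →
        ∃ F : ℂ → ℂ, DifferentiableOn ℂ F (Metric.ball (0 : ℂ) (c₀ * d)) ∧
          (∀ s : ℝ, |s| < c₀ * d →
            F (s : ℂ) = ((g (fun j => p j + s * ((u j : ℝ) / ∑ l, ((u l : ℝ)) ^ 2)) : ℝ) : ℂ)) ∧
          (∀ z : ℂ, ‖z‖ < c₀ * d → ‖F z‖ ≤ B))
    (i : Fin 3) {k : Fin 2 → ℝ} (hk : ∀ j, |k j| < Real.pi) (hK : 0 < ‖k‖) {θ : ℝ}
    (hθ : ∀ n : ℤ, ‖k‖ / 4 ≤ |θ - 2 * Real.pi * n|) :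
    ∃ Φ : ℂ → ℂ, DifferentiableOn ℂ Φ (Metric.ball (θ : ℂ) (c₀ * (‖k‖ / 4))) ∧
      ∀ s : ℝ, |s - θ| < c₀ * (‖k‖ / 4) → Φ s = ((g (Fin.insertNth i s k) : ℝ) : ℂ) := by
  obtain ⟨B, hB⟩ := hLH (‖k‖ / 4) (‖k‖ / 4) (by positivity) (by positivity)
  obtain ⟨a, ha⟩ := exists_norm_le_abs k hK
  obtain ⟨P, hP⟩ : ∃ P : Fin 3 → ℝ, P = Fin.insertNth i θ k := ⟨_, rfl⟩
  have hPi : P i = θ := by simp [hP]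
  have hPa : P (i.succAbove a) = k a := by simp [hP]
  have hU := frame_single_apply i
  have hd : ∀ n : ℤ, ‖k‖ / 4 ≤
      |(∑ j, P j * (((Pi.single i 1 : Site 3) j : ℤ) : ℝ)) - 2 * Real.pi * n| := by
    intro n; rw [frame_single_dot, hPi]; exact hθ n
  have hm : ∀ (t : ℝ) (L : Fin 3 → ℤ), ‖k‖ / 4 ≤ ‖(fun j => P j + t *
      ((((Pi.single i 1 : Site 3) j : ℤ) : ℝ) / ∑ l, (((Pi.single i 1 : Site 3) l : ℤ) : ℝ) ^ 2)
        - 2 * Real.pi * (L j : ℝ))‖ := by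
    intro t L
    set v : Fin 3 → ℝ := fun j => P j + t *
      ((((Pi.single i 1 : Site 3) j : ℤ) : ℝ) / ∑ l, (((Pi.single i 1 : Site 3) l : ℤ) : ℝ) ^ 2)
        - 2 * Real.pi * (L j : ℝ) with hv
    have h1 : |v (i.succAbove a)| ≤ ‖v‖ := by
      simpa [Real.norm_eq_abs] using norm_le_pi_norm v (i.succAbove a)
    have h2 : v (i.succAbove a) = k a - 2 * Real.pi * L (i.succAbove a) := by
      simp only [hv, hU, Fin.succAbove_ne, if_false, hPa]; ring
    have h3 := norm_le_abs_sub_two_pi_mul hk ha (L (i.succAbove a))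
    rw [h2] at h1
    linarith
  obtain ⟨F, hFd, hFt, -⟩ := hB (Pi.single i 1) (Or.inl ⟨i, rfl⟩) P hd hm
  refine ⟨fun z => F (z - θ), ?_, ?_⟩
  · refine hFd.comp (differentiableOn_id.sub_const _) fun z hz => ?_
    simpa [mem_ball, dist_eq_norm] using hz
  · intro s hs
    show F ((s : ℂ) - θ) = _
    rw [← Complex.ofReal_sub, hFt (s - θ) hs]
    congr 2
    refine (Fin.insertNth_eq_iff.2 ⟨?_, ?_⟩).symm
    · simp [hU, hPi]
    · funext l
      simp [Fin.removeNth, hU, Fin.succAbove_ne, hP]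

/-! ### Local holomorphic continuation at every point of a sharp-momentum line -/

/-- **Local continuation.** Under line holomorphy (constant `c₀`) and the cross lemma (radius `ρ`),
for every direction `i`, good reduced `k` and real `θ`, the function `s ↦ g(ins_i(s, k))` continues
holomorphically to the disc `B(θ, min(c₀,1) min(ρ,1) ‖k‖/4)` (Case A above, or Case B of file
`…CrossAssemblyAux2`, according to `dist(θ, 2πℤ) ≥ ‖k‖/4` or not). [folklore] -/
theorem exists_local_extension {g : (Fin 3 → ℝ) → ℝ} {c₀ ρ : ℝ} (hc₀ : 0 < c₀) (hρ : 0 < ρ)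
    (hLH : ∀ (d m : ℝ), 0 < d → 0 < m → ∃ B : ℝ,
      ∀ u : Site 3, ((∃ i : Fin 3, u = Pi.single i 1) ∨
          ∃ i j : Fin 3, i ≠ j ∧ (u = Pi.single i 1 + Pi.single j 1 ∨ u = Pi.single i 1 - Pi.single j 1)) →
      ∀ p : Fin 3 → ℝ, (∀ n : ℤ, d ≤ |(∑ j, p j * (u j : ℝ)) - 2 * Real.pi * n|) →
        (∀ (t : ℝ) (L : Fin 3 → ℤ), m ≤ ‖(fun j => p j + t * ((u j : ℝ) / ∑ l, ((u l : ℝ)) ^ 2)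
          - 2 * Real.pi * (L j : ℝ))‖) →
        ∃ F : ℂ → ℂ, DifferentiableOn ℂ F (Metric.ball (0 : ℂ) (c₀ * d)) ∧
          (∀ s : ℝ, |s| < c₀ * d →
            F (s : ℂ) = ((g (fun j => p j + s * ((u j : ℝ) / ∑ l, ((u l : ℝ)) ^ 2)) : ℝ) : ℂ)) ∧
          (∀ z : ℂ, ‖z‖ < c₀ * d → ‖F z‖ ≤ B))
    (hCross : ∀ (f : (Fin 3 → ℂ) → ℂ) (M : ℝ), (∀ (j : Fin 3) (a : Fin 3 → ℝ), (∀ i, |a i| ≤ 1) →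
      DifferentiableOn ℂ (fun z : ℂ => f (Function.update (fun i => ((a i : ℝ) : ℂ)) j z))
        (Metric.ball (0 : ℂ) 2)) →
      (∀ (j : Fin 3) (a : Fin 3 → ℝ) (z : ℂ), (∀ i, |a i| ≤ 1) → ‖z‖ < 2 →
        ‖f (Function.update (fun i => ((a i : ℝ) : ℂ)) j z)‖ ≤ M) →
      ∃ g : (Fin 3 → ℂ) → ℂ, AnalyticOnNhd ℂ g {z | ∀ i, ‖z i‖ < ρ} ∧
        (∀ z : Fin 3 → ℂ, (∀ i, ‖z i‖ < ρ) → ‖g z‖ ≤ M) ∧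
        ∀ (j : Fin 3) (a : Fin 3 → ℝ) (z : ℂ), (∀ i, |a i| ≤ 1) → ‖z‖ < 2 →
          (∀ i, ‖Function.update (fun i => ((a i : ℝ) : ℂ)) j z i‖ < ρ) →
          g (Function.update (fun i => ((a i : ℝ) : ℂ)) j z) =
            f (Function.update (fun i => ((a i : ℝ) : ℂ)) j z))
    (i : Fin 3) {k : Fin 2 → ℝ} (hk : ∀ j, |k j| < Real.pi) (hK : 0 < ‖k‖) (θ : ℝ) :
    ∃ Φ : ℂ → ℂ, DifferentiableOn ℂ Φ (Metric.ball (θ : ℂ) (min c₀ 1 * min ρ 1 * ‖k‖ / 4)) ∧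
      ∀ s : ℝ, |s - θ| < min c₀ 1 * min ρ 1 * ‖k‖ / 4 → Φ s = ((g (Fin.insertNth i s k) : ℝ) : ℂ) := by
  by_cases hnear : ∃ n₀ : ℤ, |θ - 2 * Real.pi * n₀| < ‖k‖ / 4
  · obtain ⟨n₀, hn₀⟩ := hnear
    obtain ⟨a', ha'⟩ := exists_norm_le_abs k hK
    exact exists_local_extension_of_near hc₀ hρ hLH hCross i hk hK ha' hn₀
  · simp only [not_exists, not_lt] at hnear
    obtain ⟨Φ, hΦd, hΦt⟩ := exists_local_extension_of_far hLH i hk hK hnear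
    have hle : min c₀ 1 * min ρ 1 * ‖k‖ / 4 ≤ c₀ * (‖k‖ / 4) := by
      have h1 : min c₀ 1 * min ρ 1 ≤ c₀ * 1 :=
        mul_le_mul (min_le_left _ _) (min_le_right _ _) (lt_min hρ one_pos).le hc₀.le
      nlinarith
    exact ⟨Φ, hΦd.mono (Metric.ball_subset_ball hle), fun s hs => hΦt s (hs.trans_le hle)⟩

/-! ### The abstract assembly: local continuations + gluing + Paley–Wiener -/

/-- **The G-side mass gap from line holomorphy and the cross lemma (abstract form).** For any
`g : ℝ³ → ℝ` whose sharp-momentum traces `θ ↦ g(ins_i(θ, k))` are `2π`-periodic, line holomorphy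
in the nine frames and the cross lemma imply: with `c = min(c₀,1) min(ρ,1)/4`, for every `i`, every
good reduced `k` and every `c' < c`, `∫_{-π}^{π} cos(nθ) g(ins_i(θ, k)) dθ ≤ C e^{-c'‖k‖n}` for all
`n`. [folklore] -/
theorem slabTransform_decay_of_lineHol_of_cross {g : (Fin 3 → ℝ) → ℝ}
    (hper : ∀ (i : Fin 3) (θ : ℝ) (k : Fin 2 → ℝ),
      g (Fin.insertNth i (θ + 2 * Real.pi) k) = g (Fin.insertNth i θ k))
    (hLH : ∃ c₀ : ℝ, 0 < c₀ ∧ ∀ (d m : ℝ), 0 < d → 0 < m → ∃ B : ℝ,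
      ∀ u : Site 3, ((∃ i : Fin 3, u = Pi.single i 1) ∨
          ∃ i j : Fin 3, i ≠ j ∧ (u = Pi.single i 1 + Pi.single j 1 ∨ u = Pi.single i 1 - Pi.single j 1)) →
      ∀ p : Fin 3 → ℝ, (∀ n : ℤ, d ≤ |(∑ j, p j * (u j : ℝ)) - 2 * Real.pi * n|) →
        (∀ (t : ℝ) (L : Fin 3 → ℤ), m ≤ ‖(fun j => p j + t * ((u j : ℝ) / ∑ l, ((u l : ℝ)) ^ 2)
          - 2 * Real.pi * (L j : ℝ))‖) →
        ∃ F : ℂ → ℂ, DifferentiableOn ℂ F (Metric.ball (0 : ℂ) (c₀ * d)) ∧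
          (∀ s : ℝ, |s| < c₀ * d →
            F (s : ℂ) = ((g (fun j => p j + s * ((u j : ℝ) / ∑ l, ((u l : ℝ)) ^ 2)) : ℝ) : ℂ)) ∧
          (∀ z : ℂ, ‖z‖ < c₀ * d → ‖F z‖ ≤ B))
    (hCross : ∃ ρ : ℝ, 0 < ρ ∧ ∀ (f : (Fin 3 → ℂ) → ℂ) (M : ℝ), (∀ (j : Fin 3) (a : Fin 3 → ℝ),
      (∀ i, |a i| ≤ 1) →
      DifferentiableOn ℂ (fun z : ℂ => f (Function.update (fun i => ((a i : ℝ) : ℂ)) j z))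
        (Metric.ball (0 : ℂ) 2)) →
      (∀ (j : Fin 3) (a : Fin 3 → ℝ) (z : ℂ), (∀ i, |a i| ≤ 1) → ‖z‖ < 2 →
        ‖f (Function.update (fun i => ((a i : ℝ) : ℂ)) j z)‖ ≤ M) →
      ∃ g : (Fin 3 → ℂ) → ℂ, AnalyticOnNhd ℂ g {z | ∀ i, ‖z i‖ < ρ} ∧
        (∀ z : Fin 3 → ℂ, (∀ i, ‖z i‖ < ρ) → ‖g z‖ ≤ M) ∧
        ∀ (j : Fin 3) (a : Fin 3 → ℝ) (z : ℂ), (∀ i, |a i| ≤ 1) → ‖z‖ < 2 →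
          (∀ i, ‖Function.update (fun i => ((a i : ℝ) : ℂ)) j z i‖ < ρ) →
          g (Function.update (fun i => ((a i : ℝ) : ℂ)) j z) =
            f (Function.update (fun i => ((a i : ℝ) : ℂ)) j z)) :
    ∃ c : ℝ, 0 < c ∧ ∀ (i : Fin 3) (k : Fin 2 → ℝ), (∀ j, |k j| < Real.pi) → (∃ j, k j ≠ 0) →
      ∀ c' : ℝ, 0 < c' → c' < c → ∃ C : ℝ, ∀ᶠ n : ℕ in Filter.atTop,
        (∫ θ in (-Real.pi)..Real.pi, Real.cos (n * θ) * g (Fin.insertNth i θ k)) ≤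
          C * Real.exp (-(c' * ‖k‖ * (n : ℝ))) := by
  obtain ⟨c₀, hc₀, hLH⟩ := hLH
  obtain ⟨ρ, hρ, hCross⟩ := hCross
  refine ⟨min c₀ 1 * min ρ 1 / 4, by positivity, ?_⟩
  intro i k hk hne c' hc' hc'c
  have hK : 0 < ‖k‖ := by
    obtain ⟨j, hj⟩ := hne
    exact lt_of_lt_of_le (abs_pos.mpr hj) (by simpa [Real.norm_eq_abs] using norm_le_pi_norm k j)
  set R : ℝ := min c₀ 1 * min ρ 1 * ‖k‖ / 4 with hRdef
  have hR : 0 < R := by positivity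
  -- local continuations, glued into a strip continuation of the periodic trace
  obtain ⟨Ψ, hΨd, hΨt⟩ := exists_differentiableOn_strip_of_balls
    (φ := fun s : ℝ => ((g (Fin.insertNth i s k) : ℝ) : ℂ)) hR
    (exists_local_extension hc₀ hρ hLH hCross i hk hK)
  set f : ℝ → ℝ := fun θ => g (Fin.insertNth i θ k) with hf
  have hfper : ∀ θ : ℝ, f (θ + 2 * Real.pi) = f θ := fun θ => hper i θ k
  have htrace : ∀ θ : ℝ, Ψ θ = (f θ : ℂ) := hΨt
  have hΨper : ∀ θ : ℝ, Ψ (θ + 2 * π) = Ψ θ := fun θ => by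
    have h := htrace (θ + 2 * Real.pi)
    push_cast at h
    rw [h, htrace θ, hfper]
  -- Paley–Wiener on the strip of half-width `R = c ‖k‖`
  have hy : c' * ‖k‖ < R := by
    rw [hRdef]
    have := mul_lt_mul_of_pos_right hc'c hK
    linarith
  obtain ⟨M, hM⟩ := exists_norm_le_of_strip hR hΨd hΨper hy
  refine ⟨2 * Real.pi * M, Filter.Eventually.of_forall fun n => ?_⟩
  have h := abs_integral_mul_cos_le_of_strip hR hΨd htrace hfper n (by positivity) hy hM
  calc (∫ θ in (-Real.pi)..Real.pi, Real.cos (n * θ) * g (Fin.insertNth i θ k))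
      = ∫ θ in (-Real.pi)..Real.pi, f θ * Real.cos (n * θ) :=
        intervalIntegral.integral_congr fun θ _ => by simp only [hf]; ring
    _ ≤ |∫ θ in (-Real.pi)..Real.pi, f θ * Real.cos (n * θ)| := le_abs_self _
    _ ≤ 2 * Real.pi * M * Real.exp (-(n * (c' * ‖k‖))) := h
    _ = 2 * Real.pi * M * Real.exp (-(c' * ‖k‖ * (n : ℝ))) := by ring_nf

/-! ### The registered sub-stub -/

/-- **Registered sub-stub `stub_slabModeExpDecay_auxCrossAssembly`** (brick of
`stub_slabModeExpDecay`; text of the lead's interface `crossAssembly_SHAPE`): for the Green symbol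
function `g(p) = (1 - ∑ₓ q(x) cos(p·x))⁻¹` of the walk dictionary (`q = 𝟙_{≠0} dcf/A₀`), LINE
HOLOMORPHY in the nine frames + the CROSS LEMMA ⇒ the G-side exponential decay `HypG` of the
sharp-momentum slab transforms at good momenta, with a rate linear in `‖k‖`
(`slabTransform_decay_of_lineHol_of_cross`; the trace `θ ↦ g(ins_i(θ, k))` is `2π`-periodic because
`x ∈ ℤ³`). [folklore] -/
theorem stub_slabModeExpDecay_auxCrossAssembly :
    (∀ A : Finset (Site 3), (Matrix.of fun (p q : ↥A) => criticalTwoPoint 3 (q.1 - p.1)).PosDef ∧ ∀ u v :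
      ↥A, (u ≠ v → (Matrix.of fun (p q : ↥A) => criticalTwoPoint 3 (q.1 - p.1))⁻¹ u v ≤ 0) ∧ 0 ≤ ∑ w,
      (Matrix.of fun (p q : ↥A) => criticalTwoPoint 3 (q.1 - p.1))⁻¹ u w) →
    ∀ A₀ : ℝ, Filter.Tendsto (fun n : ℕ => (Matrix.of fun (p q : ↥(box 3 n)) => criticalTwoPoint 3 (q.1 - p.1))⁻¹
        ⟨0, zero_mem_box 3 n⟩ ⟨0, zero_mem_box 3 n⟩) Filter.atTop (nhds A₀) →
      (∀ n : ℕ, (Matrix.of fun (p q : ↥(box 3 n)) => criticalTwoPoint 3 (q.1 - p.1))⁻¹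
        ⟨0, zero_mem_box 3 n⟩ ⟨0, zero_mem_box 3 n⟩ ≤ A₀) → 0 < A₀ →
    -- LINE HOLOMORPHY in the nine frames (conclusion of `lineHolomorphy_SHAPE`):
    (∃ c₀ : ℝ, 0 < c₀ ∧ ∀ (d m : ℝ), 0 < d → 0 < m → ∃ B : ℝ,
      ∀ u : Site 3, ((∃ i : Fin 3, u = Pi.single i 1) ∨
          ∃ i j : Fin 3, i ≠ j ∧ (u = Pi.single i 1 + Pi.single j 1 ∨ u = Pi.single i 1 - Pi.single j 1)) →
      ∀ p : Fin 3 → ℝ, (∀ n : ℤ, d ≤ |(∑ j, p j * (u j : ℝ)) - 2 * Real.pi * n|) →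
        (∀ (t : ℝ) (L : Fin 3 → ℤ), m ≤ ‖(fun j => p j + t * ((u j : ℝ) / ∑ l, ((u l : ℝ)) ^ 2)
          - 2 * Real.pi * (L j : ℝ))‖) →
        ∃ F : ℂ → ℂ, DifferentiableOn ℂ F (Metric.ball (0 : ℂ) (c₀ * d)) ∧
          (∀ s : ℝ, |s| < c₀ * d →
            F (s : ℂ) = (((1 - ∑' x : Site 3, (if x = 0 then (0 : ℝ) else
              (⨅ A : {A : Finset (Site 3) // (0 : Site 3) ∈ A ∧ x ∈ A}, -((Matrix.of fun (p q : ↥A.1) =>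
                criticalTwoPoint 3 (q.1 - p.1))⁻¹ ⟨0, A.2.1⟩ ⟨x, A.2.2⟩))) / A₀ *
              Real.cos (∑ j, (p j + s * ((u j : ℝ) / ∑ l, ((u l : ℝ)) ^ 2)) * ((x j : ℤ) : ℝ)))⁻¹ : ℝ) : ℂ)) ∧
          (∀ z : ℂ, ‖z‖ < c₀ * d → ‖F z‖ ≤ B)) →
    -- CROSS LEMMA (Bernstein–Siciak; text of line nine-frame-cross-analyticity's `CrossLemma`):
    (∃ ρ : ℝ, 0 < ρ ∧ ∀ (f : (Fin 3 → ℂ) → ℂ) (M : ℝ), (∀ (j : Fin 3) (a : Fin 3 → ℝ), (∀ i, |a i| ≤ 1) →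
    DifferentiableOn ℂ (fun z : ℂ => f (Function.update (fun i => ((a i : ℝ) : ℂ)) j z)) (Metric.ball (0 :
    ℂ) 2)) → (∀ (j : Fin 3) (a : Fin 3 → ℝ) (z : ℂ), (∀ i, |a i| ≤ 1) → ‖z‖ < 2 → ‖f (Function.update (fun
    i => ((a i : ℝ) : ℂ)) j z)‖ ≤ M) → ∃ g : (Fin 3 → ℂ) → ℂ, AnalyticOnNhd ℂ g {z | ∀ i, ‖z i‖ < ρ} ∧ (∀ z
    : Fin 3 → ℂ, (∀ i, ‖z i‖ < ρ) → ‖g z‖ ≤ M) ∧ ∀ (j : Fin 3) (a : Fin 3 → ℝ) (z : ℂ), (∀ i, |a i| ≤ 1) →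
    ‖z‖ < 2 → (∀ i, ‖Function.update (fun i => ((a i : ℝ) : ℂ)) j z i‖ < ρ) → g (Function.update (fun i =>
    ((a i : ℝ) : ℂ)) j z) = f (Function.update (fun i => ((a i : ℝ) : ℂ)) j z)) →
    -- CONCLUSION: G-side exponential decay at good momenta (`HypG` of `stub_slabModeExpDecay_auxGreenTransfer`):
    ∃ c : ℝ, 0 < c ∧ ∀ (i : Fin 3) (k : Fin 2 → ℝ), (∀ j, |k j| < Real.pi) → (∃ j, k j ≠ 0) →
      ∀ c' : ℝ, 0 < c' → c' < c → ∃ C : ℝ, ∀ᶠ n : ℕ in Filter.atTop,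
        (∫ θ in (-Real.pi)..Real.pi, Real.cos (n * θ) / (1 - ∑' x : Site 3, (if x = 0 then (0 : ℝ) else
          (⨅ A : {A : Finset (Site 3) // (0 : Site 3) ∈ A ∧ x ∈ A}, -((Matrix.of fun (p q : ↥A.1) =>
            criticalTwoPoint 3 (q.1 - p.1))⁻¹ ⟨0, A.2.1⟩ ⟨x, A.2.2⟩))) / A₀ *
          Real.cos (∑ j, (Fin.insertNth i θ k : Fin 3 → ℝ) j * ((x j : ℤ) : ℝ)))) ≤
        C * Real.exp (-(c' * ‖k‖ * (n : ℝ))) := by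
  intro _ A₀ _ _ _ hLH hCross
  -- the Green symbol function as a function on `ℝ³`
  set g : (Fin 3 → ℝ) → ℝ := fun p => (1 - ∑' x : Site 3, (if x = 0 then (0 : ℝ) else
    (⨅ A : {A : Finset (Site 3) // (0 : Site 3) ∈ A ∧ x ∈ A}, -((Matrix.of fun (p q : ↥A.1) =>
      criticalTwoPoint 3 (q.1 - p.1))⁻¹ ⟨0, A.2.1⟩ ⟨x, A.2.2⟩))) / A₀ *
    Real.cos (∑ j, p j * ((x j : ℤ) : ℝ)))⁻¹ with hg
  -- its sharp-momentum traces are `2π`-periodic (`x ∈ ℤ³`)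
  have hper : ∀ (i : Fin 3) (θ : ℝ) (k : Fin 2 → ℝ),
      g (Fin.insertNth i (θ + 2 * Real.pi) k) = g (Fin.insertNth i θ k) := by
    intro i θ k
    simp only [hg]
    congr 1
    congr 1
    refine tsum_congr fun x => ?_
    congr 1
    rw [Fin.sum_univ_succAbove _ i, Fin.sum_univ_succAbove _ i]
    simp only [Fin.insertNth_apply_same, Fin.insertNth_apply_succAbove]
    rw [show (θ + 2 * Real.pi) * ((x i : ℤ) : ℝ) + ∑ l, k l * ((x (i.succAbove l) : ℤ) : ℝ) =
      θ * ((x i : ℤ) : ℝ) + ∑ l, k l * ((x (i.succAbove l) : ℤ) : ℝ) + ((x i : ℤ) : ℝ) * (2 * Real.pi)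
      by ring, Real.cos_add_int_mul_two_pi]
  obtain ⟨c, hc, hdec⟩ := slabTransform_decay_of_lineHol_of_cross (g := g) hper hLH hCross
  refine ⟨c, hc, fun i k hk hne c' hc' hc'c => ?_⟩
  obtain ⟨C, hC⟩ := hdec i k hk hne c' hc' hc'c
  refine ⟨C, hC.mono fun n hn => ?_⟩
  simpa only [hg, div_eq_mul_inv] using hn

end Summit.CriticalPhenomena.Ising3DConformalLimit.Cruxes.DirectCorrelationStableTail.SelfEnergyPickInversion

end
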